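/-
Copyright (c) 2026 the pub-hodgecm-mathlib formalisation cell (harness21).  Prover seat hodgecm-mathlib-K2Liu-p27 (g0), Track B «K2-LIT»,
#184♮ = hLiu418 = `stmt-HodgeConjecture-24832`; #42S organ S2, S2-asm road (γ), the `hsys`∕`hval` INSTANCE, clause (real) (LEAD F0P6-plan (g14) BATCH #45 2026-09-04T15:02:53Z
«K2Liu-p27 → S2 (real)»; desk K2Liu-p05 (g6) 15:10:35Z HEAD (B): file `K2LiuArchSWSystemRealiser`, currency `𝔉 ∕ Φ_𝓢 ∕ val ∕ Y` of D2).
-/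
import Summits.HodgeConjecture.HodgeConjecture.Theorems.K2LiuArchHermiteDatum        -- ★ σ15 `isArchDatum_hermiteSpan` (+ ★ S2-D parts 1–2: `archSWValue(Linear)`, `IsArchDatum`)
import HarnessLib

/-!
# Crux `HLiu418`, #42S organ S2, S2-asm road (γ), the `hval` instance, clause (real):
# THE REALISER `Φ ↦ (V_{deg Φ}, Φ_𝓢 Φ, Y)` — every Hermite datum is realised inside an arch datum, with `archSWValue sB Y (Φ_𝓢 Φ) = val Φ` on the nose

Cell `hodgecm-mathlib`, crux item hLiu418 = `stmt-HodgeConjecture-24832`; squad K2 ∕ K2Liu; LEAD F0P6-plan (g14), co-dealer K2E5-plan (g7), S2 desk K2Liu-p05 (g6); prover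
K2Liu-p27 (g0).  THEOREMS ONLY (no `def`, no instance, no notation, no named-fact hypothesis, no `sorry`); lane `--supports stmt-HodgeConjecture-24832 --as helper`.

THE CURRENCY (desk K2Liu-p05 (g6) 2026-09-04T15:10:35Z, shared with D2 `K2LiuArchSWSystemDerivative` — ONE currency for the whole `hval` of ★∕📤 ED. 3
`K2LiuArchSWSpanningInstance.archSWRegionSpanning_of_readings_on`):
* `𝔉 := ((Fin (n′+n′) × {v : InfinitePlace L⁺ // v.IsReal}) →₀ ℕ) →₀ ℂ` — finitely supported Hermite data (multi-index ↦ coefficient);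
* `Φ_𝓢 := Finsupp.linearCombination ℂ (γ ↦ follandHermite frameD γ)` — the Hermite vector `Σ_γ Φ(γ) · h_γ` of the Folland frame `frameD` of the big datum `𝔻 ⊗ V′`
  (★ `follandHermite`, ★ `GRConstruction.frameD`);
* `val := (archSWValueLinear sB Y).comp Φ_𝓢` — the arch value `a ↦ f_{Φ_𝓢 Φ ⊗ ⊗Y}((a, 1_f))` of ★ S2-D part 1 (`archSWValueLinear_apply = archSWValue`), for ONE fixed finite test vector `Y`.
THE CLAUSE (real) of ED. 3, VERBATIM up to the frame letters (here a general real diagonal frame `dV′`; the instance reads `dV′ := c • dV₀`):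
  `∀ Φ : 𝔉, ∃ V ΦS Y′, IsArchDatum 𝒦 sB V ∧ ΦS ∈ V ∧ ∀ a, archSWValue sB Y′ ΦS a = val Φ a`.
THE REALISER: `Y′ := Y`, `ΦS := Φ_𝓢 Φ` (so the third conjunct is `rfl`), `V := V_D = span {follandHermite frameD γ | γ.degree ≤ D}` with `D := sup_{γ ∈ supp Φ} |γ|`
(so `Φ_𝓢 Φ ∈ V_D` term by term), and `IsArchDatum 𝒦 sB V_D` is ★ σ15 `K2LiuArchHermiteDatum.isArchDatum_hermiteSpan` — whose binders `hχu hχs hsB ht hodd` (the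
`χ`-normalised doubled Weil representation and its arch type), `y hy hz eP eQ hE` (the junction frame data of ★ 3-b) and **`hK`** (census (G5): the arch part of `𝒦.K` lies in the
submonoid generated by the one-place frame compacts `placeSec_𝔻 σ h` with the Fock property) are carried HYPOTHESIS-FIRST, byte for byte as σ15 states them.
ON (G5) `hK` (honest): it is NOT a consequence of ★ `IwasawaDatum.IsStd` alone — (P2) of `IsStd` pins the arch part `C_∞` to the stabiliser of SOME positive majorant
(frame `S`, existential), a maximal compact subgroup of `H_∞` of majorant type, whereas the place sections `placeSec_𝔻 σ h` generate the ONE maximal compact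
`∏_σ U(p_σ) × U(q_σ)` of the DIAGONAL frame of `J^𝔻 = hermD`; the two agree iff the datum's majorant is the diagonal one.  So `hK` is a genuine restriction on `𝒦`
(satisfied by the tree's diagonal-frame data), kept as a binder here exactly as in σ15; the Fock half of (G5) (every `placeSec_𝔻 σ h`, `h ∈ U(p_σ) × U(q_σ)`, has the
Fock property) is ★ `K2LiuArchWeilFockFiniteDatum.weilDatum_κ_mem_fockLe` up to the `Fin 2` relabelling and is not consumed by this clause.
References: [Folland1989] §1.7, Prop. (4.39); [Howe1989] §3 (K-finite vectors = polynomial × Gaussian); [HarrisKudlaSweet1996] §1 (1.15)–(1.17); [KudlaRallis1994] §1;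
[KonnoKonno2007] §3.3.
HONEST LABEL.  Count-neutral helper: `HC_CM` is proved only modulo the 7 printed citations (2 remaining named inputs: hLiu418 = `stmt-HodgeConjecture-24832`,
h413 = `stmt-HodgeConjecture-24833`) until rung 0 closes; this file closes no socket — it discharges the (real) conjunct of the `hval` instance modulo σ15's binders.
-/

set_option autoImplicit false
set_option linter.dupNamespace false -- the mandated namespace repeats `HodgeConjecture.HodgeConjecture`
set_option synthInstance.maxSize 512 -- `DecidableEq` of the nested block index (as ★ σ15 `K2LiuArchHermiteDatum`)

noncomputable section

open scoped Classical Matrix TensorProduct Kronecker SchwartzMap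
open NumberField NumberField.InfinitePlace NumberField.mixedEmbedding IsDedekindDomain
open Literature.Analysis.SegalBargmann Literature.RepresentationTheory.HeisenbergGroup
open Literature.NumberTheory.Automorphic Literature.NumberTheory.Automorphic.UnitaryGroup Literature.NumberTheory.GaloisRepresentations
open Literature.NumberTheory.Weil1964 Literature.NumberTheory.Weil1964.MpS Literature.NumberTheory.Weil1964.UnitaryWeil
open Literature.RepresentationTheory.HarrisKudlaSweet1996
open Literature.RepresentationTheory.KonnoKonno2007 Literature.RepresentationTheory.KonnoKonno2007.RealDualPair
open Literature.NumberTheory.GelbartRogawski1991 Literature.NumberTheory.GelbartRogawski1991.GRConstruction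
open Literature.NumberTheory.GelbartRogawski1991.UnitaryDualPair
open Literature.NumberTheory.GelbartRogawski1991.UnitaryDualPair.LocalSplitting
open Literature.NumberTheory.K2Lit.SiegelDoubled
open Summit.HodgeConjecture.HodgeConjecture.Cruxes.HLiu418.K2LiuArchSectionPlaceBlock
open Summit.HodgeConjecture.HodgeConjecture.Cruxes.HLiu418.K2LiuWeilSeesawRelabel
open Summit.HodgeConjecture.HodgeConjecture.Cruxes.HLiu418.K2LiuArchTensorPlaceSec
open Summit.HodgeConjecture.HodgeConjecture.Cruxes.HLiu418.K2LiuArchHermiteGlue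
open Summit.HodgeConjecture.HodgeConjecture.Cruxes.HLiu418.K2LiuArchSWImageDefs
open Summit.HodgeConjecture.HodgeConjecture.Cruxes.HLiu418.K2LiuArchSWSpanningDefs
open Summit.HodgeConjecture.HodgeConjecture.Cruxes.HLiu418.K2LiuArchHermiteDatum

namespace Summit.HodgeConjecture.HodgeConjecture.Cruxes.HLiu418.K2LiuArchSWSystemRealiser

variable (L : Type) [Field L] [NumberField L] [IsCMField L]
variable {N M n : ℕ} (e : Fin N × Fin M ≃ Fin n)
  (dV : Fin N → L) (hdV : ∀ i, IsCMField.complexConj L (dV i) = dV i) (hdV0 : ∀ i, dV i ≠ 0)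
  (dW : Fin M → L) (hdW : ∀ i, IsCMField.complexConj L (dW i) = dW i) (hdW0 : ∀ i, dW i ≠ 0)
variable {M₂ M' n' : ℕ} (eW : Fin M × Fin M₂ ≃ Fin M') (e' : Fin N × Fin M' ≃ Fin n')
  (dV' : Fin M₂ → L) (hdV' : ∀ k, IsCMField.complexConj L (dV' k) = dV' k) (hdV'0 : ∀ k, dV' k ≠ 0)

-- the doubled metaplectic carrier of the big datum and the CM sign frames elaborate slowly (as ★ σ15)
set_option maxHeartbeats 4000000

/-! ## §1 The Hermite vector of a finitely supported datum lies in the Hermite span of its degree -/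

/-- `Φ_𝓢 Φ = Σ_γ Φ(γ) · h_γ ∈ V_D` for `D = sup_{γ ∈ supp Φ} |γ|` — stated over an arbitrary Hermite family `v` (any function of the multi-index), so that the
frame never elaborates here. [cite: Folland1989, §1.7] -/
theorem linearCombination_mem_span_degree_le {ι : Type*} {W : Type*} [AddCommGroup W] [Module ℂ W] (v : (ι →₀ ℕ) → W) (Φ : (ι →₀ ℕ) →₀ ℂ) :
    Finsupp.linearCombination ℂ v Φ ∈ Submodule.span ℂ {x : W | ∃ γ : ι →₀ ℕ, γ.degree ≤ (Φ.support.sup fun γ' => γ'.degree) ∧ v γ = x} := by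
  rw [Finsupp.linearCombination_apply]
  refine Submodule.finsuppSum_mem (R := ℂ) _ _ _ fun γ hγ => Submodule.smul_mem _ _ (Submodule.subset_span ?_)
  exact ⟨γ, Finset.le_sup (f := fun γ' : ι →₀ ℕ => γ'.degree) (Finsupp.mem_support_iff.2 hγ), rfl⟩

/-! ## §2 The (real) clause of the `hval` instance -/

include hdW0 in
/-- **CLAUSE (real) OF THE `hval` INSTANCE — THE REALISER.**  In the currency `𝔉 = ((Fin (n′+n′) × real places) →₀ ℕ) →₀ ℂ`, `Φ_𝓢 = Finsupp.linearCombination ℂ (follandHermite frameD)`,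
`val = (archSWValueLinear sB Y).comp Φ_𝓢` (desk K2Liu-p05 (g6), shared with D2): for every datum `Φ : 𝔉` there are an arch datum `V` for `(𝒦, sB)`, a vector `ΦS ∈ V` and a
finite test vector `Y′` with `archSWValue sB Y′ ΦS = val Φ` — namely `V := V_D` the Hermite span of degree `D = sup_{supp Φ} |γ|` (an arch datum by ★ σ15
`isArchDatum_hermiteSpan`, binders `hχu hχs hsB ht hodd y hy hz eP eQ hE 𝒦 hK` carried verbatim), `ΦS := Φ_𝓢 Φ` (§1), `Y′ := Y` (the identity is `rfl`).
[cite: Folland1989, §1.7, Prop. (4.39)] [cite: Howe1989, §3] [cite: HarrisKudlaSweet1996, §1 (1.15)–(1.17)] [cite: KudlaRallis1994, §1] -/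
theorem realiser_of_hK {χ : HeckeCharacter L} (hχu : χ.IsUnitary) (hχs : IsSplittingChar L 1 χ)
    {sB : HA L e' dV hdV (tensorFrame L dW eW dV') (tensorFrame_real L dW hdW eW dV' hdV') →* MpD L e' dV hdV (tensorFrame L dW eW dV') (tensorFrame_real L dW hdW eW dV' hdV')}
    (hsB : IsDoubledWeilRep L e' dV hdV hdV0 (tensorFrame L dW eW dV') (tensorFrame_real L dW hdW eW dV' hdV')
      (tensorFrame_ne_zero L dW eW dV' hdW0 hdV'0) χ sB)
    {t : InfinitePlace L → ℤ} (ht : χ.HasUnitaryArchType t 0) (hodd : ∀ w, Odd (t w))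
    (y : ∀ σ : {v : InfinitePlace (Fp L) // v.IsReal}, Fin M₂ → ℝ)
    (hy : ∀ σ : {v : InfinitePlace (Fp L) // v.IsReal}, ∀ k, (y σ) k ≠ 0)
    (hz : ∀ σ : {v : InfinitePlace (Fp L) // v.IsReal}, ∀ j, signVec (cmPlaceOver L)
        (fun k => Sum.elim (cmGramEntry L e' dV hdV (tensorFrame L dW eW dV') (tensorFrame_real L dW hdW eW dV' hdV'))
          (-cmGramEntry L e' dV hdV (tensorFrame L dW eW dV') (tensorFrame_real L dW hdW eW dV' hdV')) ((LocalSplitting.e₂ n').symm k))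
        (imagUnit L) σ j =
      signVec (cmPlaceOver L)
          (fun k => Sum.elim (cmGramEntry L e dV hdV dW hdW) (-cmGramEntry L e dV hdV dW hdW) ((LocalSplitting.e₂ n).symm k)) (imagUnit L) σ
          ((epsD e eW e').symm j).1 * (y σ) ((epsD e eW e').symm j).2)
    (eP : ∀ σ : {v : InfinitePlace (Fp L) // v.IsReal}, (PosIdx (signVec (cmPlaceOver L)
          (fun k => Sum.elim (cmGramEntry L e dV hdV dW hdW) (-cmGramEntry L e dV hdV dW hdW) ((LocalSplitting.e₂ n).symm k)) (imagUnit L) σ) × PosIdx (y σ)) ⊕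
        (NegIdx (signVec (cmPlaceOver L)
          (fun k => Sum.elim (cmGramEntry L e dV hdV dW hdW) (-cmGramEntry L e dV hdV dW hdW) ((LocalSplitting.e₂ n).symm k)) (imagUnit L) σ) × NegIdx (y σ)) ≃
      PosIdx (signVec (cmPlaceOver L)
        (fun k => Sum.elim (cmGramEntry L e' dV hdV (tensorFrame L dW eW dV') (tensorFrame_real L dW hdW eW dV' hdV'))
          (-cmGramEntry L e' dV hdV (tensorFrame L dW eW dV') (tensorFrame_real L dW hdW eW dV' hdV')) ((LocalSplitting.e₂ n').symm k))
        (imagUnit L) σ))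
    (eQ : ∀ σ : {v : InfinitePlace (Fp L) // v.IsReal}, (PosIdx (signVec (cmPlaceOver L)
          (fun k => Sum.elim (cmGramEntry L e dV hdV dW hdW) (-cmGramEntry L e dV hdV dW hdW) ((LocalSplitting.e₂ n).symm k)) (imagUnit L) σ) × NegIdx (y σ)) ⊕
        (NegIdx (signVec (cmPlaceOver L)
          (fun k => Sum.elim (cmGramEntry L e dV hdV dW hdW) (-cmGramEntry L e dV hdV dW hdW) ((LocalSplitting.e₂ n).symm k)) (imagUnit L) σ) × PosIdx (y σ)) ≃
      NegIdx (signVec (cmPlaceOver L)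
        (fun k => Sum.elim (cmGramEntry L e' dV hdV (tensorFrame L dW eW dV') (tensorFrame_real L dW hdW eW dV' hdV'))
          (-cmGramEntry L e' dV hdV (tensorFrame L dW eW dV') (tensorFrame_real L dW hdW eW dV' hdV')) ((LocalSplitting.e₂ n').symm k))
        (imagUnit L) σ))
    (hE : ∀ σ : {v : InfinitePlace (Fp L) // v.IsReal}, ∀ i, (dpEquiv _ _ _ _).symm (((eP σ).sumCongr (eQ σ)).symm i) =
      (signSplit (signVec (cmPlaceOver L)
          (fun k => Sum.elim (cmGramEntry L e dV hdV dW hdW) (-cmGramEntry L e dV hdV dW hdW) ((LocalSplitting.e₂ n).symm k)) (imagUnit L) σ)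
        ((epsD e eW e').symm ((signSplit (signVec (cmPlaceOver L)
          (fun k => Sum.elim (cmGramEntry L e' dV hdV (tensorFrame L dW eW dV') (tensorFrame_real L dW hdW eW dV' hdV'))
            (-cmGramEntry L e' dV hdV (tensorFrame L dW eW dV') (tensorFrame_real L dW hdW eW dV' hdV')) ((LocalSplitting.e₂ n').symm k))
          (imagUnit L) σ)).symm i)).1,
       signSplit (y σ) ((epsD e eW e').symm ((signSplit (signVec (cmPlaceOver L)
          (fun k => Sum.elim (cmGramEntry L e' dV hdV (tensorFrame L dW eW dV') (tensorFrame_real L dW hdW eW dV' hdV'))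
            (-cmGramEntry L e' dV hdV (tensorFrame L dW eW dV') (tensorFrame_real L dW hdW eW dV' hdV')) ((LocalSplitting.e₂ n').symm k))
          (imagUnit L) σ)).symm i)).2))
    (𝒦 : IwasawaDatum L e dV hdV dW hdW)
    (hK : ∀ ainf : UnitaryGroup.arch (Fp L) L (IsCMField.complexConj L) (n + n) (hermD L e dV hdV dW hdW),
      (UnitaryGroup.archToAdelic (Fp L) L (IsCMField.complexConj L) (n + n) (hermD L e dV hdV dW hdW) ainf : HA L e dV hdV dW hdW) ∈ 𝒦.K →
      ainf ∈ Submonoid.closure {k : UnitaryGroup.arch (Fp L) L (IsCMField.complexConj L) (n + n) (hermD L e dV hdV dW hdW) |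
        ∃ (σ : {v : InfinitePlace (Fp L) // v.IsReal}) (h : UForm (PosIdx (signVec (cmPlaceOver L) (fun k => Sum.elim (cmGramEntry L e dV hdV dW hdW) (-cmGramEntry L e dV hdV dW hdW) ((LocalSplitting.e₂ n).symm k)) (imagUnit L) σ)) (NegIdx (signVec (cmPlaceOver L) (fun k => Sum.elim (cmGramEntry L e dV hdV dW hdW) (-cmGramEntry L e dV hdV dW hdW) ((LocalSplitting.e₂ n).symm k)) (imagUnit L) σ))),
          (∀ β₁ : DPIdx (PosIdx (signVec (cmPlaceOver L) (fun k => Sum.elim (cmGramEntry L e dV hdV dW hdW) (-cmGramEntry L e dV hdV dW hdW) ((LocalSplitting.e₂ n).symm k)) (imagUnit L) σ)) (NegIdx (signVec (cmPlaceOver L) (fun k => Sum.elim (cmGramEntry L e dV hdV dW hdW) (-cmGramEntry L e dV hdV dW hdW) ((LocalSplitting.e₂ n).symm k)) (imagUnit L) σ)) (PosIdx (y σ)) (NegIdx (y σ)) →₀ ℕ,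
            (weilRep (α := ((PosIdx (signVec (cmPlaceOver L) (fun k => Sum.elim (cmGramEntry L e dV hdV dW hdW) (-cmGramEntry L e dV hdV dW hdW) ((LocalSplitting.e₂ n).symm k)) (imagUnit L) σ)) × (PosIdx (y σ))) ⊕ ((NegIdx (signVec (cmPlaceOver L) (fun k => Sum.elim (cmGramEntry L e dV hdV dW hdW) (-cmGramEntry L e dV hdV dW hdW) ((LocalSplitting.e₂ n).symm k)) (imagUnit L) σ)) × (NegIdx (y σ)))) (β := ((PosIdx (signVec (cmPlaceOver L) (fun k => Sum.elim (cmGramEntry L e dV hdV dW hdW) (-cmGramEntry L e dV hdV dW hdW) ((LocalSplitting.e₂ n).symm k)) (imagUnit L) σ)) × (NegIdx (y σ))) ⊕ ((NegIdx (signVec (cmPlaceOver L) (fun k => Sum.elim (cmGramEntry L e dV hdV dW hdW) (-cmGramEntry L e dV hdV dW hdW) ((LocalSplitting.e₂ n).symm k)) (imagUnit L) σ)) × (PosIdx (y σ))))).comp (toBig (PosIdx (signVec (cmPlaceOver L) (fun k => Sum.elim (cmGramEntry L e dV hdV dW hdW) (-cmGramEntry L e dV hdV dW hdW) ((LocalSplitting.e₂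 n).symm k)) (imagUnit L) σ)) (NegIdx (signVec (cmPlaceOver L) (fun k => Sum.elim (cmGramEntry L e dV hdV dW hdW) (-cmGramEntry L e dV hdV dW hdW) ((LocalSplitting.e₂ n).symm k)) (imagUnit L) σ)) (PosIdx (y σ)) (NegIdx (y σ))) ((h, (1 : UForm (PosIdx (y σ)) (NegIdx (y σ)))) : Ginf (PosIdx (signVec (cmPlaceOver L) (fun k => Sum.elim (cmGramEntry L e dV hdV dW hdW) (-cmGramEntry L e dV hdV dW hdW) ((LocalSplitting.e₂ n).symm k)) (imagUnit L) σ)) (NegIdx (signVec (cmPlaceOver L) (fun k => Sum.elim (cmGramEntry L e dV hdV dW hdW) (-cmGramEntry L e dV hdV dW hdW) ((LocalSplitting.e₂ n).symm k)) (imagUnit L) σ)) (PosIdx (y σ)) (NegIdx (y σ))) (hermitePi β₁) ∈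
              Submodule.span ℂ {x : 𝓢((DPIdx (PosIdx (signVec (cmPlaceOver L) (fun k => Sum.elim (cmGramEntry L e dV hdV dW hdW) (-cmGramEntry L e dV hdV dW hdW) ((LocalSplitting.e₂ n).symm k)) (imagUnit L) σ)) (NegIdx (signVec (cmPlaceOver L) (fun k => Sum.elim (cmGramEntry L e dV hdV dW hdW) (-cmGramEntry L e dV hdV dW hdW) ((LocalSplitting.e₂ n).symm k)) (imagUnit L) σ)) (PosIdx (y σ)) (NegIdx (y σ)) → ℝ), ℂ) | ∃ γ : DPIdx (PosIdx (signVec (cmPlaceOver L) (fun k => Sum.elim (cmGramEntry L e dV hdV dW hdW) (-cmGramEntry L e dV hdV dW hdW) ((LocalSplitting.e₂ n).symm k)) (imagUnit L) σ)) (NegIdx (signVec (cmPlaceOver L) (fun k => Sum.elim (cmGramEntry L e dV hdV dW hdW) (-cmGramEntry L e dV hdV dW hdW) ((LocalSplitting.e₂ n).symm k)) (imagUnit L) σ)) (PosIdx (y σ)) (NegIdx (y σ)) →₀ ℕ, γ.degree ≤ β₁.degree ∧ hermitePi γ = x}) ∧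
          k = (placeSec L (IsCMField.complexConj L) (n + n) (IsCMField.complexConj_ne_one L) (cmPlaceOver L) (cmPlaceOver_smul L) _
          (gramD_gram_realDiagonal_entry_ne_zero L e dV hdV dW hdW hdV0 hdW0) (complexConj_imagUnit L) (imagUnit_ne_zero L) σ
          (cmPlaceOver_comap L) (gramD_eq_diagonal_cm L e dV hdV dW hdW) (J := hermD L e dV hdV dW hdW) rfl
          (complexConj_smul_infinitePlace L) h)})
    (Y : LocalSBFamily (Fp L) (Fin (n' + n'))) (Φ : ((Fin (n' + n') × {v : InfinitePlace (Fp L) // v.IsReal}) →₀ ℕ) →₀ ℂ) :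
    ∃ (V : Submodule ℂ (SchwartzMap (Fin (n' + n') → mixedEmbedding.mixedSpace (Fp L)) ℂ))
      (ΦS : SchwartzMap (Fin (n' + n') → mixedEmbedding.mixedSpace (Fp L)) ℂ) (Y' : LocalSBFamily (Fp L) (Fin (n' + n'))),
      IsArchDatum L e dV hdV dW hdW eW e' dV' hdV' sB 𝒦 V ∧ ΦS ∈ V ∧
      ∀ a : UnitaryGroup.arch (Fp L) L (IsCMField.complexConj L) (n + n) (hermD L e dV hdV dW hdW),
        archSWValue L e dV hdV hdV0 dW hdW hdW0 eW e' dV' hdV' hdV'0 sB Y' ΦS a =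
          ((archSWValueLinear L e dV hdV hdV0 dW hdW hdW0 eW e' dV' hdV' hdV'0 sB Y).comp
            (Finsupp.linearCombination ℂ fun γ : (Fin (n' + n') × {v : InfinitePlace (Fp L) // v.IsReal}) →₀ ℕ =>
              follandHermite (GRConstruction.frameD L e' dV hdV hdV0 (tensorFrame L dW eW dV') (tensorFrame_real L dW hdW eW dV' hdV') (tensorFrame_ne_zero L dW eW dV' hdW0 hdV'0)) γ)) Φ a := by
  refine ⟨_, Finsupp.linearCombination ℂ (fun γ : (Fin (n' + n') × {v : InfinitePlace (Fp L) // v.IsReal}) →₀ ℕ =>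
      follandHermite (GRConstruction.frameD L e' dV hdV hdV0 (tensorFrame L dW eW dV') (tensorFrame_real L dW hdW eW dV' hdV') (tensorFrame_ne_zero L dW eW dV' hdW0 hdV'0)) γ) Φ, Y,
    isArchDatum_hermiteSpan L e dV hdV hdV0 dW hdW hdW0 eW e' dV' hdV' hdV'0 hχu hχs hsB ht hodd y hy hz eP eQ hE 𝒦 hK (Φ.support.sup fun γ' => γ'.degree),
    linearCombination_mem_span_degree_le _ Φ, fun a => rfl⟩

end Summit.HodgeConjecture.HodgeConjecture.Cruxes.HLiu418.K2LiuArchSWSystemRealiser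

end
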